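/-
Copyright (c) 2026 the pub-hodgecm-mathlib formalisation cell (harness21).  Prover seat hodgecm-mathlib-LH4-p11 (g9), req620 Track A «(D-RAM) FOUR-FRAME» squad, helper lane on
h413 = stmt-HodgeConjecture-24833 (count-neutral).  β-BOARD v1 ROW R6a «THE PER-LATTICE κ-CLASS READ OF TOWER 1», FILE C: the per-orbit values of slots `0` and `1` in CLOSED FORM (the
two tokens REF5 #R5-353 listed as owed, discharged here).  2026-09-04.
-/
import Summits.HodgeConjecture.HodgeConjecture.Theorems.F0P3cDyRamLabelledOddKappaClassValueG1    -- ★ FILE B (this seat): `labelledOddCount_div_relIndex_glued_rep_kappaLocus`, `forall_normSign_{zero,one}_mul_kappaChar_iff`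
import HarnessLib

/-!
# Crux `H413`, line LH4 «(D-RAM) FOUR-FRAME» — (β-BAL) Stage B, β-BOARD ROW R6a (tower 1), FILE C: the κ-class glued representative's labelled odd value in slots `0` and `1`,
# CLOSED FORM — `slot 0 = ω(e_A·(1+r(g)))∕2 · [2d ≤ ρ + 2k + 1] · w`, `slot 1 = ω(g·e_A·(1+r(g)))∕2 · [2d ≤ ρ + 1] · w`

Cell `hodgecm-mathlib` (D-0151), FLOOR 0, crux item H413 = `stmt-HodgeConjecture-24833`, route `HCCMUnconditional`; squad F0∕P3c∕LH4.  THEOREMS ONLY (no `def`, no instance, no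
notation, no `sorry`, default heartbeats); ★-only imports; lane `--supports stmt-HodgeConjecture-24833 --as helper` (count-neutral); pays NO row, states NO law.
WHAT.  ★ FILE B gives the per-orbit value on the κ-locus glued representative `latt V(1,1,g)` with the indicator `[∀ u ∈ S_F, ω(u_i)·μ_c(u) = 1]` left abstract, and the two indicator
dictionaries.  Here the two tokens of `c = r∕(1+r)` (`σ c = c`, `|c| = |ϖ|^{2k}` — `|r| = |ϖ|^{2k}`, `|1 + r| = 1`) are discharged and the signs simplified (`ω(D(g)₀) = ω(g)` and
`ω(D(g)₁) = 1`, the norm `π₀^{−(ρ+t′)} = N(ϖ^{−(ρ+t′)})` leaving `ω`; `ω(g)² = 1`): **`labelledOddCount_div_relIndex_glued_rep_kappaLocus_zero`** (own slot of tower 1)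
`= ω(e_A·(1+r))∕2 · [2d ≤ ρ + 2k + 1] · stabiliserWeight` and **`labelledOddCount_div_relIndex_glued_rep_kappaLocus_one`** `= ω(g·e_A·(1+r))∕2 · [2d ≤ ρ + 1] · stabiliserWeight`,
`r = e_B·π₀^{t′+k}∕(g·e_A)`.  The own-slot value does not see `ω(g)`: summed over the `g`-transversal of the stratum it is `ω(e_A)∕2 · Σ_g ω(1 + C∕g)`-shaped (`|C∕g| = |ϖ|^{2k}`,
`2k = n₁ − n₂ − s`) — LH4-cdis1 (g0)'s boundary factor `F(n_{X*} − m − s)` (R6b, LH4-p08 (g10), ★ p861700 line total); slot 1 carries `ω(g)` and sums to the half∕half zero.  Slot 2 is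
the sequel (LH4-p17 (g0)'s R3 slot-2 file, mirrored).
HONEST LABEL.  Count-neutral (`--supports`); nothing printed is asserted; R6b, slot 2, hRest, (β) `stub_law_cleanSgn`, T₊ remain OPEN; `HC_CM` is proved only modulo the 7 printed citations
(2 remaining named inputs: hLiu418 = `stmt-HodgeConjecture-24832`, h413 = `stmt-HodgeConjecture-24833`) until rung 0 closes.
References: [Kottwitz1986BaseChangeUnits] §1 pp. 240–241 · [Rogawski1990] §4.9 Prop. 4.9.1 (a)(b) p. 55, §4.10 p. 58 · [LanglandsShelstad1987] §3 · [Serre1979] Ch. V §3 Cor. 3, Ch. XV §2.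
-/

set_option autoImplicit false

noncomputable section

namespace Summit.HodgeConjecture.HodgeConjecture.Cruxes.H413.F0P3cDyRamLabelledOddKappaClassValueG1Slots

open Matrix WithZero
open Literature.NumberTheory.Automorphic Literature.NumberTheory.Automorphic.HermitianLattice Literature.NumberTheory.Automorphic.UnitaryGroup
open Literature.NumberTheory.Automorphic.UnitaryLatticeTree Literature.NumberTheory.Automorphic.UnitaryThreeFourFrame
open Literature.NumberTheory.LocalFields Literature.NumberTheory.LocalFields.WildQuadraticDatum
open Summit.HodgeConjecture.HodgeConjecture.Cruxes.H413.F0P3cDyRamFourFramePieces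
open Summit.HodgeConjecture.HodgeConjecture.Cruxes.H413.F0P3cDyRamFourFrameCensusDefs
open Summit.HodgeConjecture.HodgeConjecture.Cruxes.H413.F0P3cDyRamStageOneBDefs (mcOfRecord)
open Summit.HodgeConjecture.HodgeConjecture.Cruxes.H413.F0P3cDyRamDiagonalTorusDefs
open Summit.HodgeConjecture.HodgeConjecture.Cruxes.H413.F0P3cDyRamLabelledOddCountDefs
open Summit.HodgeConjecture.HodgeConjecture.Cruxes.H413.F0P3cDyRamFixedCountDiagonalModel (normSign_mul_norm)
open Summit.HodgeConjecture.HodgeConjecture.Cruxes.H413.F0P3cDyRamDiagonalKappaSplitCountEval (normSign_mul_self)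
open Summit.HodgeConjecture.HodgeConjecture.Cruxes.H413.F0P3cDyRamLabelledOddKappaClassValueG1
open scoped Valued WithZero Matrix MatrixGroups

variable {K : Type} [Field K] [Valued K ℤᵐ⁰] [CompleteSpace K] [Fintype 𝓀[K]] {σ : K →+* K} {ϖ : K} {d t : ℕ} {α β : K} {N₀ n₁ n₂ n₃ : ℕ}

/-- **THE TWO TOKENS OF `c = r∕(1+r)` AND THE TWO SIGNS**: with `r = e_B·π₀^{t′+k}∕(g·e_A)` (`g, e_A, e_B` fixed, `|g| = |ϖ|^{2t′}`, `|e_A| = |e_B| = 1`, `k ≥ 1`): `σ c = c`,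
`|c| = |ϖ|^{2k}`, `ω(π₀^{−(ρ+t′)}·g) = ω(g)`, `ω(π₀^{−(ρ+t′)}) = 1`, and `ω(g·e_A·(1+r))·ω(g) = ω(e_A·(1+r))`. [cite: Serre1979, Ch. V §3 Cor. 3] [cite: Rogawski1990, §4.9 p. 55] -/
theorem kappaChar_tokens (hD : IsRamifiedQuadraticDatum σ ϖ d t) {ρ t' : ℕ} {g : K} (hσg : σ g = g) (hg : Valued.v g = Valued.v ϖ ^ (2 * t'))
    (k : ℕ) (hk : 1 ≤ k) {eA : K} (hσeA : σ eA = eA) (heA1 : Valued.v eA = 1) {eB : K} (hσeB : σ eB = eB) (heB1 : Valued.v eB = 1) :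
    σ (eB * (ϖ * σ ϖ) ^ (t' + k) / (g * eA) / (1 + eB * (ϖ * σ ϖ) ^ (t' + k) / (g * eA))) = eB * (ϖ * σ ϖ) ^ (t' + k) / (g * eA) / (1 + eB * (ϖ * σ ϖ) ^ (t' + k) / (g * eA)) ∧
    Valued.v (eB * (ϖ * σ ϖ) ^ (t' + k) / (g * eA) / (1 + eB * (ϖ * σ ϖ) ^ (t' + k) / (g * eA))) = Valued.v ϖ ^ (2 * k) ∧
    normSign σ ((![((ϖ * σ ϖ) ^ (ρ + t'))⁻¹ * g, ((ϖ * σ ϖ) ^ (ρ + t'))⁻¹, -(((ϖ * σ ϖ) ^ (ρ + t'))⁻¹ * (1 + g)⁻¹)] : Fin 3 → K) 0) = normSign σ g ∧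
    normSign σ ((![((ϖ * σ ϖ) ^ (ρ + t'))⁻¹ * g, ((ϖ * σ ϖ) ^ (ρ + t'))⁻¹, -(((ϖ * σ ϖ) ^ (ρ + t'))⁻¹ * (1 + g)⁻¹)] : Fin 3 → K) 1) = 1 ∧
    (normSign σ (g * eA * (1 + eB * (ϖ * σ ϖ) ^ (t' + k) / (g * eA))) : ℤ) * normSign σ g = normSign σ (eA * (1 + eB * (ϖ * σ ϖ) ^ (t' + k) / (g * eA))) := by
  have hD' := hD
  obtain ⟨hσ, hvσ, hϖ, -, -, -, -⟩ := hD'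
  haveI : Finite 𝓀[K] := Finite.of_fintype _
  have hϖ0 : ϖ ≠ 0 := fun h0 => by rw [h0, map_zero] at hϖ; exact WithZero.coe_ne_zero hϖ.symm
  have hϖ1 : Valued.v ϖ < 1 := by rw [hϖ, ← WithZero.exp_zero, WithZero.exp_lt_exp]; norm_num
  have hσϖ0 : σ ϖ ≠ 0 := (map_ne_zero σ).2 hϖ0
  have hq : ∀ n : ℕ, Valued.v ϖ ^ n = WithZero.exp (-(n : ℤ)) := fun n => v_varpi_pow hϖ n
  have hvπ : ∀ m : ℕ, Valued.v ((ϖ * σ ϖ) ^ m) = WithZero.exp (-((2 * m : ℕ) : ℤ)) := fun m => by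
    rw [map_pow, map_mul, hvσ, ← pow_two, ← pow_mul, v_varpi_pow hϖ]
  have hπσ : ∀ m : ℕ, σ ((ϖ * σ ϖ) ^ m) = (ϖ * σ ϖ) ^ m := fun m => by rw [map_pow, map_mul, hσ, mul_comm]
  have hg0 : g ≠ 0 := fun h => by
    rw [h, map_zero] at hg; exact (pow_ne_zero _ ((Valuation.ne_zero_iff _).2 hϖ0)) hg.symm
  have heA0 : eA ≠ 0 := fun h => by rw [h, map_zero] at heA1; exact zero_ne_one heA1
  set r : K := eB * (ϖ * σ ϖ) ^ (t' + k) / (g * eA) with hrdef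
  have hσr : σ r = r := by rw [hrdef, map_div₀, map_mul, map_mul, hσeB, hπσ, hσg, hσeA]
  have hvr : Valued.v r = Valued.v ϖ ^ (2 * k) := by
    rw [hrdef, map_div₀, map_mul, map_mul, heB1, one_mul, hvπ, hg, heA1, mul_one, hq, hq, ← WithZero.exp_sub]
    congr 1; push_cast; ring
  have hrlt : Valued.v r < 1 := by rw [hvr]; exact pow_lt_one₀ zero_le hϖ1 (by omega)
  have h1r : Valued.v (1 + r) = 1 := Valued.v.map_one_add_of_lt hrlt
  have h1r0 : (1 : K) + r ≠ 0 := fun h => by rw [h, map_zero] at h1r; exact zero_ne_one h1r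
  have hσ1r : σ (1 + r) = 1 + r := by rw [map_add, map_one, hσr]
  refine ⟨by rw [map_div₀, hσr, hσ1r], by rw [map_div₀, h1r, div_one, hvr], ?_, ?_, ?_⟩
  · show normSign σ (((ϖ * σ ϖ) ^ (ρ + t'))⁻¹ * g) = normSign σ g
    rw [show ((ϖ * σ ϖ) ^ (ρ + t'))⁻¹ * g = g * ((ϖ ^ (ρ + t'))⁻¹ * σ ((ϖ ^ (ρ + t'))⁻¹)) by rw [map_inv₀, map_pow, ← mul_inv, ← mul_pow]; ring,
      normSign_mul_norm σ _ (inv_ne_zero (pow_ne_zero _ hϖ0))]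
  · show normSign σ (((ϖ * σ ϖ) ^ (ρ + t'))⁻¹) = 1
    rw [show ((ϖ * σ ϖ) ^ (ρ + t'))⁻¹ = (1 : K) * ((ϖ ^ (ρ + t'))⁻¹ * σ ((ϖ ^ (ρ + t'))⁻¹)) by rw [map_inv₀, map_pow, ← mul_inv, ← mul_pow, one_mul],
      normSign_mul_norm σ _ (inv_ne_zero (pow_ne_zero _ hϖ0))]
    exact normSign_of_isNorm σ ⟨1, by rw [map_one, one_mul]⟩
  · rw [show g * eA * (1 + r) = g * (eA * (1 + r)) by ring,
      normSign_mul_of_fixed hD hσg (by rw [map_mul, hσeA, hσ1r]) hg0 (mul_ne_zero heA0 h1r0), mul_comm, ← mul_assoc, normSign_mul_self, one_mul]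

open Classical in
/-- **SLOT `0` (THE OWN SLOT OF TOWER 1), CLOSED FORM**: on the κ-locus glued representative `latt V(1,1,g)` (hypotheses of ★ FILE B's head, plus `|2| < 1` for the killer),
`labelledOddCount σ ϖ 0 0 Λ (latt V) ∕ [𝒰 : N(S̃′)] = ω(e_A·(1 + r))∕2 · [2d ≤ ρ + 2k + 1] · stabiliserWeight σ (latt V)`, `r = e_B·π₀^{t′+k}∕(g·e_A)` — ★ FILE B's head, its slot-0
indicator dictionary (`|c| = |ϖ|^{2k}` exactly) and `ω(g·e_A·(1+r))·ω(D(g)₀) = ω(e_A·(1+r))`.  The orbit parameter `g` survives only inside `1 + r(g)`, `|r(g)| = |ϖ|^{n₁ − n₂ − s}`.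
[cite: Kottwitz1986BaseChangeUnits, §1 pp. 240–241] [cite: LanglandsShelstad1987, §3] [cite: Serre1979, Ch. V §3 Cor. 3; Ch. XV §2] [cite: Rogawski1990, §4.9 Prop. 4.9.1 (a)(b) p. 55, §4.10 p. 58] -/
theorem labelledOddCount_div_relIndex_glued_rep_kappaLocus_zero (hD : IsRamifiedQuadraticDatum σ ϖ d t) (h2 : Valued.v (2 : K) < 1) (h2d : 2 ≤ d)
    (hE : IsElementDatum σ ϖ N₀ α β n₁ n₂ n₃) (hmc : mcOfRecord d ≤ N₀)
    {T : GL (Fin 3) K} (hT : (T : Matrix (Fin 3) (Fin 3) K) = Matrix.diagonal ![α, β, 1])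
    {ρ t' : ℕ} (hρ : 1 ≤ ρ) (ht' : 1 ≤ t') {g : K} (hσg : σ g = g) (hg : Valued.v g = Valued.v ϖ ^ (2 * t'))
    (V : GL (Fin 3) K) (hV : (V : Matrix (Fin 3) (Fin 3) K) = !![1, 0, 0; 1, ϖ ^ ρ, 0; 1 * 1 + g, ϖ ^ ρ * 1, ϖ ^ (2 * ρ + 2 * t')])
    (hn : IsNormalisedLattice (latt (V : Matrix (Fin 3) (Fin 3) K)))
    (hTM : mapGL T (latt (V : Matrix (Fin 3) (Fin 3) K)) = latt (V : Matrix (Fin 3) (Fin 3) K))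
    (hlev : LatticeInLevel ϖ (d % 2) (Matrix.diagonal ![α - 1, β - 1, 0]) (latt (V : Matrix (Fin 3) (Fin 3) K)))
    (hnlev : ¬ LatticeInLevel ϖ (d % 2 + 1) (Matrix.diagonal ![α - 1, β - 1, 0]) (latt (V : Matrix (Fin 3) (Fin 3) K)))
    (hsq : LatticeInLevel ϖ (mcOfRecord d) (Matrix.diagonal ![(α - 1) * (α - 1), (β - 1) * (β - 1), 0]) (latt (V : Matrix (Fin 3) (Fin 3) K)))
    (hfin : {M : Submodule 𝒪[K] (Fin 3 → K) | ∃ u ∈ unitTorus K 3, M = mapGL (diagGLUnits u) (latt (V : Matrix (Fin 3) (Fin 3) K))}.Finite)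
    (hκ : 2 * ρ + d % 2 = n₂) (k : ℕ) (hk : 1 ≤ k) (hk₁ : 2 * (ρ + t' + k) + d % 2 = n₁)
    {eA : K} (hσeA : σ eA = eA) (heA1 : Valued.v eA = 1)
    (heA : Valued.v ((ϖ ^ (d % 2 + 2 * d - 1))⁻¹ * ((α - 1) * ((ϖ * σ ϖ) ^ ρ)⁻¹ - eA * ((ϖ - σ ϖ) * ((ϖ * σ ϖ) ^ ((d - d % 2) / 2))⁻¹))) ≤ 1)
    {eB : K} (hσeB : σ eB = eB) (heB1 : Valued.v eB = 1)
    (heB : Valued.v ((ϖ ^ (d % 2 + 2 * d - 1))⁻¹ * ((β - 1) * ((ϖ * σ ϖ) ^ (ρ + t' + k))⁻¹ - eB * ((ϖ - σ ϖ) * ((ϖ * σ ϖ) ^ ((d - d % 2) / 2))⁻¹))) ≤ 1) :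
    (labelledOddCount σ ϖ 0 0 (valueClassLabel σ ϖ (α - 1) (β - 1) (d % 2 + 2 * d - 1) d) (latt (V : Matrix (Fin 3) (Fin 3) K)) : ℚ) /
        ((((unitStabilizer (latt (V : Matrix (Fin 3) (Fin 3) K))).map (unitNormMap σ 3)).relIndex (fixedUnitTorus σ 3) : ℕ) : ℚ) =
      (normSign σ (eA * (1 + eB * (ϖ * σ ϖ) ^ (t' + k) / (g * eA))) : ℚ) / 2 *
        ((if 2 * d ≤ ρ + 2 * k + 1 then 1 else 0 : ℤ) : ℚ) * stabiliserWeight σ (latt (V : Matrix (Fin 3) (Fin 3) K)) := by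
  obtain ⟨hσc, hcv, hω0, -, hεω⟩ := kappaChar_tokens (ρ := ρ) hD hσg hg k hk hσeA heA1 hσeB heB1
  have hind := forall_normSign_zero_mul_kappaChar_iff hD h2 hρ ht' hσg hg V hV hσc (k := 2 * k) (by omega) hcv
  rw [labelledOddCount_div_relIndex_glued_rep_kappaLocus hD h2d hE hmc hT hρ ht' hσg hg V hV hn hTM hlev hnlev hsq hfin hκ k hk hk₁ hσeA heA1 heA hσeB heB1 heB 0, hω0]
  have hεω' : (normSign σ (g * eA * (1 + eB * (ϖ * σ ϖ) ^ (t' + k) / (g * eA))) : ℚ) * (normSign σ g : ℚ) =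
      (normSign σ (eA * (1 + eB * (ϖ * σ ϖ) ^ (t' + k) / (g * eA))) : ℚ) := by exact_mod_cast hεω
  by_cases hc : 2 * d ≤ ρ + 2 * k + 1
  · rw [if_pos (hind.2 hc), if_pos hc, ← hεω']
  · rw [if_neg (fun h => hc (hind.1 h)), if_neg hc]; simp

open Classical in
/-- **SLOT `1`, CLOSED FORM**: under the same hypotheses,
`labelledOddCount σ ϖ 0 1 Λ (latt V) ∕ [𝒰 : N(S̃′)] = ω(g·e_A·(1 + r))∕2 · [2d ≤ ρ + 1] · stabiliserWeight σ (latt V)` (★ FILE B + its slot-1 dictionary; `ω(D(g)₁) = 1`) — the orbit sign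
`ω(g)` survives, so the `g`-sum over the stratum is the half∕half zero (R6b). [cite: Kottwitz1986BaseChangeUnits, §1 pp. 240–241] [cite: LanglandsShelstad1987, §3] [cite: Serre1979, Ch. V §3 Cor. 3; Ch. XV §2] -/
theorem labelledOddCount_div_relIndex_glued_rep_kappaLocus_one (hD : IsRamifiedQuadraticDatum σ ϖ d t) (h2 : Valued.v (2 : K) < 1) (h2d : 2 ≤ d)
    (hE : IsElementDatum σ ϖ N₀ α β n₁ n₂ n₃) (hmc : mcOfRecord d ≤ N₀)
    {T : GL (Fin 3) K} (hT : (T : Matrix (Fin 3) (Fin 3) K) = Matrix.diagonal ![α, β, 1])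
    {ρ t' : ℕ} (hρ : 1 ≤ ρ) (ht' : 1 ≤ t') {g : K} (hσg : σ g = g) (hg : Valued.v g = Valued.v ϖ ^ (2 * t'))
    (V : GL (Fin 3) K) (hV : (V : Matrix (Fin 3) (Fin 3) K) = !![1, 0, 0; 1, ϖ ^ ρ, 0; 1 * 1 + g, ϖ ^ ρ * 1, ϖ ^ (2 * ρ + 2 * t')])
    (hn : IsNormalisedLattice (latt (V : Matrix (Fin 3) (Fin 3) K)))
    (hTM : mapGL T (latt (V : Matrix (Fin 3) (Fin 3) K)) = latt (V : Matrix (Fin 3) (Fin 3) K))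
    (hlev : LatticeInLevel ϖ (d % 2) (Matrix.diagonal ![α - 1, β - 1, 0]) (latt (V : Matrix (Fin 3) (Fin 3) K)))
    (hnlev : ¬ LatticeInLevel ϖ (d % 2 + 1) (Matrix.diagonal ![α - 1, β - 1, 0]) (latt (V : Matrix (Fin 3) (Fin 3) K)))
    (hsq : LatticeInLevel ϖ (mcOfRecord d) (Matrix.diagonal ![(α - 1) * (α - 1), (β - 1) * (β - 1), 0]) (latt (V : Matrix (Fin 3) (Fin 3) K)))
    (hfin : {M : Submodule 𝒪[K] (Fin 3 → K) | ∃ u ∈ unitTorus K 3, M = mapGL (diagGLUnits u) (latt (V : Matrix (Fin 3) (Fin 3) K))}.Finite)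
    (hκ : 2 * ρ + d % 2 = n₂) (k : ℕ) (hk : 1 ≤ k) (hk₁ : 2 * (ρ + t' + k) + d % 2 = n₁)
    {eA : K} (hσeA : σ eA = eA) (heA1 : Valued.v eA = 1)
    (heA : Valued.v ((ϖ ^ (d % 2 + 2 * d - 1))⁻¹ * ((α - 1) * ((ϖ * σ ϖ) ^ ρ)⁻¹ - eA * ((ϖ - σ ϖ) * ((ϖ * σ ϖ) ^ ((d - d % 2) / 2))⁻¹))) ≤ 1)
    {eB : K} (hσeB : σ eB = eB) (heB1 : Valued.v eB = 1)
    (heB : Valued.v ((ϖ ^ (d % 2 + 2 * d - 1))⁻¹ * ((β - 1) * ((ϖ * σ ϖ) ^ (ρ + t' + k))⁻¹ - eB * ((ϖ - σ ϖ) * ((ϖ * σ ϖ) ^ ((d - d % 2) / 2))⁻¹))) ≤ 1) :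
    (labelledOddCount σ ϖ 0 1 (valueClassLabel σ ϖ (α - 1) (β - 1) (d % 2 + 2 * d - 1) d) (latt (V : Matrix (Fin 3) (Fin 3) K)) : ℚ) /
        ((((unitStabilizer (latt (V : Matrix (Fin 3) (Fin 3) K))).map (unitNormMap σ 3)).relIndex (fixedUnitTorus σ 3) : ℕ) : ℚ) =
      (normSign σ (g * eA * (1 + eB * (ϖ * σ ϖ) ^ (t' + k) / (g * eA))) : ℚ) / 2 *
        ((if 2 * d ≤ ρ + 1 then 1 else 0 : ℤ) : ℚ) * stabiliserWeight σ (latt (V : Matrix (Fin 3) (Fin 3) K)) := by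
  obtain ⟨hσc, hcv, -, hω1, -⟩ := kappaChar_tokens (ρ := ρ) hD hσg hg k hk hσeA heA1 hσeB heB1
  have hind := forall_normSign_one_mul_kappaChar_iff hD h2 hρ ht' hσg hg V hV hσc (k := 2 * k) (by omega) hcv.le
  rw [labelledOddCount_div_relIndex_glued_rep_kappaLocus hD h2d hE hmc hT hρ ht' hσg hg V hV hn hTM hlev hnlev hsq hfin hκ k hk hk₁ hσeA heA1 heA hσeB heB1 heB 1, hω1]
  by_cases hc : 2 * d ≤ ρ + 1
  · rw [if_pos (hind.2 hc), if_pos hc]; push_cast; ring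
  · rw [if_neg (fun h => hc (hind.1 h)), if_neg hc]; simp

end Summit.HodgeConjecture.HodgeConjecture.Cruxes.H413.F0P3cDyRamLabelledOddKappaClassValueG1Slots

end
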